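import Literature.AlgebraicGeometry.Motives.HodgeLieWeilSquareOrbit
import Literature.Algebra.Lie.IrreducibleLinearLieAlgebraRankOneIdempotent
import Literature.AlgebraicGeometry.Motives.HodgeLieRankThreeSpanC
import Literature.AlgebraicGeometry.Motives.HodgeLieWeightOneProjector
import HarnessLib

/-!
# The Weil square with a rank-one raising operator: the Hodge-degree-zero part of `Lie Hg ⊗ ℂ` realises EVERY endomorphism of `W⁺` (and of `W⁻`) — brick S1 (r = 1) of the (3|3) WEIL square

Family `hodge`, layer `Literature/AlgebraicGeometry/Motives` (abstract polarizable `ℚ`-Hodge structures; no geometry), namespace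
`Literature.AlgebraicGeometry.Motives.HodgeStructure`, grouping sub-namespace `WeilSquare`. THEOREMS ONLY (no definition, no named
fact, no `sorry`). Written for the cell `pub-hodgeav-hg6` (req-37 (A) Q2b; eng-4 g7, brick S1 (r = 1) of `HOME/jobs/WEIL33-eng4g7/DESIGN.md`
REV 2 §5: the hypothesis `hproj` of eng-5's `LieGoursatTwist.lift_or_twist_of_submodules` for the pair `(W⁺, W⁻)`). HONEST FRAMING: nothing
here proves HC / HC_AV / HC_CM; unconditional linear algebra of Hodge structures; no step towards a summit statement.

SETTING (`Motives/HodgeThetaSubalgebraUnitary`): `H` effective polarized of weight `1`, `φ ∈ End_Hdg(V)`, `φ² = −d` (`d > 0`),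
`End_Hdg(V) = ℚ + ℚφ`, `μ² = −d`, `W = ker(φ_ℂ − μ)`, `W^± = W ∩ V^{1,0} / V^{0,1}`, `𝔥_ℂ = hodgeLieC H`,
`𝔊⁰ = {Y ∈ 𝔥_ℂ : Y V^{1,0} ⊆ V^{1,0}, Y V^{0,1} ⊆ V^{0,1}}` (the Hodge-degree-zero part).

MAIN THEOREM **`WeilSquare.exists_restrict_plus_eq_of_rankOne`**: if `𝔥_ℂ` contains a RAISING operator `N` (`N V^{1,0} = 0`,
`N V_ℂ ⊆ V^{1,0}`) which on `W⁻` has RANK ONE — `N w = η(w) u` for `w ∈ W⁻` with `u ∈ W⁺` and `N|_{W⁻} ≠ 0` — then EVERY `ℂ`-linear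
endomorphism of `W⁺` is the restriction of an element of `𝔊⁰`; likewise for `W⁻` (**`WeilSquare.exists_restrict_minus_eq_of_rankOne`**).
PROOF. With `N̄ = conj ∘ N ∘ conj ∈ 𝔥_ℂ` (`conjOp_mem_spanC`; lowering; `N̄ W⁺ ⊆ W⁻`) the commutator `R = [N, N̄] ∈ 𝔊⁰` acts on `W⁺` as
the RANK-ONE operator `p ↦ η(N̄ p) u`, whose «trace» `η(N̄ u)` is NON-ZERO: `ψ_ℂ(N N̄ u, ū) = −ψ_ℂ(z̄, z) ≠ 0` for
`z = N ū ≠ 0` (`Polarization.form_conj_ne_zero`, second Hodge–Riemann relation; `z ≠ 0` because `ψ_ℂ(z, w) = −η(w) ψ_ℂ(ū, u)`).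
The restrictions `𝔊⁰|_{W⁺} ⊆ End(W⁺)` form a commutator-closed subspace acting IRREDUCIBLY (S0 `WeilSquare.eq_bot_or_eq_plus_of_stable`,
the orbit lemma over G3), so the tree's `Literature.Algebra.Lie.eq_top_of_irreducible_of_smulRight_mem` (an irreducible linear Lie
algebra containing a rank-one non-nilpotent operator is `𝔤𝔩`) gives `𝔊⁰|_{W⁺} = End(W⁺)`. On `W⁻` the operator `[N̄, N]` acts as
`w ↦ η(w) N̄ u`, rank one with the same non-zero trace.
(Gordon 1997 §6, proof of 6.3.3: «`MT(A,ℂ) → GL(W′)`» and the orbit of a highest-weight line; Moonen–Zarhin 1999 (2.3).)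

## References

* [Gordon1997] B. B. Gordon, arXiv:alg-geom/9709030, §6 (proof of Thm. 6.3.3, pp. 18–19).
* [MoonenZarhin1999LowDim] B. Moonen, Yu. Zarhin, Math. Ann. 315 (1999), §2 (2.3), §3 proof of Lemma (3.4).
* [Humphreys1972] J. E. Humphreys, GTM 9, §19.1–19.2 (irreducible linear Lie algebras; matrix units).
-/

noncomputable section

open scoped TensorProduct

namespace Literature.AlgebraicGeometry.Motives

namespace HodgeStructure

universe u

variable {V : Type u} [AddCommGroup V] [Module ℚ V] [Module.Finite ℚ V] [HodgeTensorFacts.{u, u}] {n : ℤ}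

/-! ### §1 The restrictions of `𝔊⁰` to `W⁺` form an irreducible commutator-closed subspace of `End(W⁺)` -/

set_option maxHeartbeats 800000 in
/-- **Packaging + irreducibility.** For any `Y₀ ∈ 𝔊⁰` (in `𝔥_ℂ`, preserving `V^{1,0}` and `V^{0,1}`) and any functional `α` on
`W⁺ = W ∩ V^{1,0}` with a vector `u ∈ W⁺`, `α(u) ≠ 0`, such that `Y₀` acts on `W⁺` as `p ↦ α(p) u`: every endomorphism of `W⁺` is the
restriction of an element of `𝔊⁰` (`Literature.Algebra.Lie.eq_top_of_irreducible_of_smulRight_mem` for the subspace of restrictions,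
irreducible by S0 `WeilSquare.eq_bot_or_eq_plus_of_stable`). [cite: Gordon1997, §6 (proof of Thm. 6.3.3, p. 19)] [cite: Humphreys1972, §19.1–§19.2] -/
theorem WeilSquare.exists_restrict_plus_eq_of_smulRight (H : HodgeStructure V n) (hn : n = 1) (heff : H.IsEffective)
    (ψ : H.Polarization) {φ : Module.End ℚ V} (hφE : φ ∈ H.endAlg) {d : ℚ} (hd : 0 < d) (hφ2 : φ * φ = -(d • 1))
    (hE : ∀ a ∈ H.endAlg, ∃ x y : ℚ, a = x • 1 + y • φ) {μ : ℂ} (hμ : μ ^ 2 = -(d : ℂ))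
    {Y₀ : Module.End ℂ (ℂ ⊗[ℚ] V)} (hY₀ : Y₀ ∈ H.hodgeLieC) (hY₀P : ∀ p ∈ H.piece 1 0, Y₀ p ∈ H.piece 1 0)
    (hY₀Q : ∀ q ∈ H.piece 0 1, Y₀ q ∈ H.piece 0 1)
    (α : Module.Dual ℂ ↥(Module.End.eigenspace (φ.baseChange ℂ) μ ⊓ H.piece 1 0))
    (u : ↥(Module.End.eigenspace (φ.baseChange ℂ) μ ⊓ H.piece 1 0)) (hαu : α u ≠ 0)
    (hY₀W : ∀ p : ↥(Module.End.eigenspace (φ.baseChange ℂ) μ ⊓ H.piece 1 0), Y₀ p = α p • (u : ℂ ⊗[ℚ] V)) :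
    ∀ F : Module.End ℂ ↥(Module.End.eigenspace (φ.baseChange ℂ) μ ⊓ H.piece 1 0),
      ∃ Y ∈ H.hodgeLieC, (∀ p ∈ H.piece 1 0, Y p ∈ H.piece 1 0) ∧ (∀ q ∈ H.piece 0 1, Y q ∈ H.piece 0 1) ∧
        ∀ p : ↥(Module.End.eigenspace (φ.baseChange ℂ) μ ⊓ H.piece 1 0), Y p = F p := by
  classical
  have hcφ : ∀ {Y}, Y ∈ H.hodgeLieC → Y * φ.baseChange ℂ = φ.baseChange ℂ * Y := fun {Y} hY =>
    H.commute_baseChange_of_mem_hodgeLieC hY ⟨φ, hφE⟩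
  -- the degree-zero part `𝔊⁰` as a subspace, and its restriction to `W⁺`
  set G0 : Submodule ℂ (Module.End ℂ (ℂ ⊗[ℚ] V)) :=
    { carrier := {Y | Y ∈ H.hodgeLieC ∧ (∀ p ∈ H.piece 1 0, Y p ∈ H.piece 1 0) ∧ (∀ q ∈ H.piece 0 1, Y q ∈ H.piece 0 1)}
      zero_mem' := ⟨Submodule.zero_mem _, fun p _ => by rw [LinearMap.zero_apply]; exact Submodule.zero_mem _,
        fun q _ => by rw [LinearMap.zero_apply]; exact Submodule.zero_mem _⟩
      add_mem' := fun {Y Y'} hY hY' => ⟨Submodule.add_mem _ hY.1 hY'.1,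
        fun p hp => by rw [LinearMap.add_apply]; exact Submodule.add_mem _ (hY.2.1 p hp) (hY'.2.1 p hp),
        fun q hq => by rw [LinearMap.add_apply]; exact Submodule.add_mem _ (hY.2.2 q hq) (hY'.2.2 q hq)⟩
      smul_mem' := fun c Y hY => ⟨Submodule.smul_mem _ c hY.1,
        fun p hp => by rw [LinearMap.smul_apply]; exact Submodule.smul_mem _ c (hY.2.1 p hp),
        fun q hq => by rw [LinearMap.smul_apply]; exact Submodule.smul_mem _ c (hY.2.2 q hq)⟩ } with hG0def
  have hmemG0 : ∀ {Y}, Y ∈ G0 ↔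
      Y ∈ H.hodgeLieC ∧ (∀ p ∈ H.piece 1 0, Y p ∈ H.piece 1 0) ∧ (∀ q ∈ H.piece 0 1, Y q ∈ H.piece 0 1) := fun {Y} => Iff.rfl
  have hG0W : ∀ Y : G0, ∀ x ∈ Module.End.eigenspace (φ.baseChange ℂ) μ ⊓ H.piece 1 0, (Y : Module.End ℂ (ℂ ⊗[ℚ] V)) x ∈ Module.End.eigenspace (φ.baseChange ℂ) μ ⊓ H.piece 1 0 := fun Y x hx =>
    Submodule.mem_inf.2 ⟨UnitaryTheta.apply_mem_eigenspace_of_commute (hcφ Y.2.1) (Submodule.mem_inf.1 hx).1,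
      Y.2.2.1 x (Submodule.mem_inf.1 hx).2⟩
  have hG0br : ∀ Y ∈ G0, ∀ Y' ∈ G0, Y * Y' - Y' * Y ∈ G0 := fun Y hY Y' hY' =>
    ⟨H.commutator_mem_hodgeLieC hY.1 hY'.1,
      fun p hp => by
        rw [LinearMap.sub_apply, Module.End.mul_apply, Module.End.mul_apply]
        exact Submodule.sub_mem _ (hY.2.1 _ (hY'.2.1 p hp)) (hY'.2.1 _ (hY.2.1 p hp)),
      fun q hq => by
        rw [LinearMap.sub_apply, Module.End.mul_apply, Module.End.mul_apply]
        exact Submodule.sub_mem _ (hY.2.2 _ (hY'.2.2 q hq)) (hY'.2.2 _ (hY.2.2 q hq))⟩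
  set res : G0 →ₗ[ℂ] Module.End ℂ ↥(Module.End.eigenspace (φ.baseChange ℂ) μ ⊓ H.piece 1 0) :=
    { toFun := fun Y => (Y : Module.End ℂ (ℂ ⊗[ℚ] V)).restrict (hG0W Y)
      map_add' := fun Y Y' => LinearMap.ext fun w => Subtype.ext rfl
      map_smul' := fun c Y => LinearMap.ext fun w => Subtype.ext rfl } with hres
  have hresapply : ∀ (Y : G0) (w : ↥(Module.End.eigenspace (φ.baseChange ℂ) μ ⊓ H.piece 1 0)), ((res Y w : ↥(Module.End.eigenspace (φ.baseChange ℂ) μ ⊓ H.piece 1 0)) : ℂ ⊗[ℚ] V) = (Y : Module.End ℂ (ℂ ⊗[ℚ] V)) w := fun Y w => rfl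
  set 𝔏 : Submodule ℂ (Module.End ℂ ↥(Module.End.eigenspace (φ.baseChange ℂ) μ ⊓ H.piece 1 0)) := LinearMap.range res with h𝔏def
  -- `𝔏` is commutator-closed
  have h𝔏br : ∀ A ∈ 𝔏, ∀ B ∈ 𝔏, A * B - B * A ∈ 𝔏 := by
    rintro _ ⟨Y, rfl⟩ _ ⟨Y', rfl⟩
    refine ⟨⟨(Y : Module.End ℂ (ℂ ⊗[ℚ] V)) * (Y' : Module.End ℂ (ℂ ⊗[ℚ] V)) -
        (Y' : Module.End ℂ (ℂ ⊗[ℚ] V)) * (Y : Module.End ℂ (ℂ ⊗[ℚ] V)), hG0br Y Y.2 Y' Y'.2⟩, LinearMap.ext fun w => Subtype.ext ?_⟩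
    simp only [hresapply, LinearMap.sub_apply, Module.End.mul_apply, Submodule.coe_sub]
  -- `𝔏` acts irreducibly on `W⁺` (S0)
  have h𝔏irr : ∀ U : Submodule ℂ ↥(Module.End.eigenspace (φ.baseChange ℂ) μ ⊓ H.piece 1 0), (∀ A ∈ 𝔏, ∀ x ∈ U, A x ∈ U) → U = ⊥ ∨ U = ⊤ := by
    intro U hU
    set U₀ : Submodule ℂ (ℂ ⊗[ℚ] V) := U.map (Module.End.eigenspace (φ.baseChange ℂ) μ ⊓ H.piece 1 0).subtype with hU₀
    have hU₀le : U₀ ≤ Module.End.eigenspace (φ.baseChange ℂ) μ ⊓ H.piece 1 0 := by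
      rintro _ ⟨x, -, rfl⟩; exact x.2
    have hU₀st : ∀ Y ∈ H.hodgeLieC, (∀ p ∈ H.piece 1 0, Y p ∈ H.piece 1 0) → (∀ q ∈ H.piece 0 1, Y q ∈ H.piece 0 1) →
        ∀ x ∈ U₀, Y x ∈ U₀ := by
      rintro Y hY hYP hYQ _ ⟨x, hx, rfl⟩
      have h := hU (res ⟨Y, hY, hYP, hYQ⟩) (LinearMap.mem_range_self res _) x hx
      exact ⟨_, h, rfl⟩
    rcases WeilSquare.eq_bot_or_eq_plus_of_stable H hn heff ψ hφE hd hφ2 hE hμ U₀ hU₀le hU₀st with h | h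
    · left
      rw [eq_bot_iff]
      intro x hx
      have hx0 : (x : ℂ ⊗[ℚ] V) ∈ U₀ := ⟨x, hx, rfl⟩
      rw [h, Submodule.mem_bot] at hx0
      rw [Submodule.mem_bot]
      exact Subtype.ext hx0
    · right
      apply Submodule.map_injective_of_injective (Module.End.eigenspace (φ.baseChange ℂ) μ ⊓ H.piece 1 0).injective_subtype
      rw [Submodule.map_subtype_top]
      exact h
  -- the rank-one non-nilpotent element `Y₀|_{W⁺} = α.smulRight u`
  have hP : α.smulRight u ∈ 𝔏 := by
    refine ⟨⟨Y₀, hY₀, hY₀P, hY₀Q⟩, LinearMap.ext fun p => Subtype.ext ?_⟩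
    rw [hresapply, LinearMap.smulRight_apply, Submodule.coe_smul]
    exact hY₀W p
  have htop := Literature.Algebra.Lie.eq_top_of_irreducible_of_smulRight_mem h𝔏br h𝔏irr hP hαu
  intro F
  have hF : F ∈ 𝔏 := htop ▸ Submodule.mem_top
  obtain ⟨Y, hY⟩ := hF
  refine ⟨Y, Y.2.1, Y.2.2.1, Y.2.2.2, fun p => ?_⟩
  rw [← hY, hresapply]

/-! ### §2 A rank-one raising operator produces the rank-one non-nilpotent element `[N, N̄]|_{W⁺}` -/

set_option maxHeartbeats 1600000 in
/-- **The Weil square with a rank-one raising operator: `𝔊⁰|_{W⁺} = End(W⁺)`.** If `N ∈ 𝔥_ℂ` is raising (`N V^{1,0} = 0`,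
`N V_ℂ ⊆ V^{1,0}`) and acts on `W⁻ = W ∩ V^{0,1}` as the rank-one operator `w ↦ η(w) u` (`u ∈ W⁺`), non-zero on `W⁻`, then every
endomorphism of `W⁺` is the restriction of an element of `𝔥_ℂ` preserving `V^{1,0}` and `V^{0,1}`: `[N, N̄]` (`N̄ = conj ∘ N ∘ conj`) acts
on `W⁺` as `p ↦ η(N̄ p) u` with `η(N̄ u) ≠ 0` by the second Hodge–Riemann relation, and §1 applies.
[cite: Gordon1997, §6 (proof of Thm. 6.3.3, pp. 18–19)] [cite: MoonenZarhin1999LowDim, §2 (2.3)] -/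
theorem WeilSquare.exists_restrict_plus_eq_of_rankOne (H : HodgeStructure V n) (hn : n = 1) (heff : H.IsEffective)
    (ψ : H.Polarization) {φ : Module.End ℚ V} (hφE : φ ∈ H.endAlg) {d : ℚ} (hd : 0 < d) (hφ2 : φ * φ = -(d • 1))
    (hE : ∀ a ∈ H.endAlg, ∃ x y : ℚ, a = x • 1 + y • φ) {μ : ℂ} (hμ : μ ^ 2 = -(d : ℂ))
    {N : Module.End ℂ (ℂ ⊗[ℚ] V)} (hN : N ∈ H.hodgeLieC) (hNP : ∀ p ∈ H.piece 1 0, N p = 0) (hNim : ∀ v, N v ∈ H.piece 1 0)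
    {η : Module.Dual ℂ (ℂ ⊗[ℚ] V)} {u : ℂ ⊗[ℚ] V} (hu : u ∈ Module.End.eigenspace (φ.baseChange ℂ) μ ⊓ H.piece 1 0)
    (hNW : ∀ w ∈ Module.End.eigenspace (φ.baseChange ℂ) μ ⊓ H.piece 0 1, N w = η w • u)
    (hN0 : ∃ w ∈ Module.End.eigenspace (φ.baseChange ℂ) μ ⊓ H.piece 0 1, N w ≠ 0) :
    ∀ F : Module.End ℂ ↥(Module.End.eigenspace (φ.baseChange ℂ) μ ⊓ H.piece 1 0),
      ∃ Y ∈ H.hodgeLieC, (∀ p ∈ H.piece 1 0, Y p ∈ H.piece 1 0) ∧ (∀ q ∈ H.piece 0 1, Y q ∈ H.piece 0 1) ∧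
        ∀ p : ↥(Module.End.eigenspace (φ.baseChange ℂ) μ ⊓ H.piece 1 0), Y p = F p := by
  classical
  subst hn
  set W := Module.End.eigenspace (φ.baseChange ℂ) μ with hWdef
  set ψC := ψ.form.baseChange ℂ with hψC
  obtain ⟨hμ0, hμc⟩ := UnitaryTheta.conj_eq_neg_of_sq hd hμ
  obtain ⟨huW, huP⟩ := Submodule.mem_inf.1 hu
  have hcφ : ∀ {Y}, Y ∈ H.hodgeLieC → Y * φ.baseChange ℂ = φ.baseChange ℂ * Y := fun {Y} hY =>
    H.commute_baseChange_of_mem_hodgeLieC hY ⟨φ, hφE⟩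
  have hYW : ∀ {Y}, Y ∈ H.hodgeLieC → ∀ w ∈ W, Y w ∈ W := fun {Y} hY w hw =>
    UnitaryTheta.apply_mem_eigenspace_of_commute (hcφ hY) hw
  have hPQ : ∀ x ∈ H.piece 1 0, conj x ∈ H.piece 0 1 := fun x hx => conj_mem_piece H hx
  have hQP : ∀ x ∈ H.piece 0 1, conj x ∈ H.piece 1 0 := fun x hx => conj_mem_piece H hx
  -- conj exchanges `W` and `W̄`
  have hcW : ∀ x ∈ W, conj x ∈ Module.End.eigenspace (φ.baseChange ℂ) (-μ) := fun x hx =>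
    (UnitaryTheta.conj_mem_eigenspace_iff φ hμc x).2 hx
  have hcWbar : ∀ x ∈ Module.End.eigenspace (φ.baseChange ℂ) (-μ), conj x ∈ W := fun x hx =>
    (UnitaryTheta.conj_mem_eigenspace_iff' φ hμc x).2 hx
  -- the conjugate `N̄`, lowering, in `𝔥_ℂ`
  obtain ⟨Nb, hNb⟩ := exists_conjOp N
  have hNb𝔥 : Nb ∈ H.hodgeLieC := by
    rw [hodgeLieC_eq_spanC] at hN ⊢
    exact conjOp_mem_spanC hN hNb
  have hNbQ : ∀ q ∈ H.piece 0 1, Nb q = 0 := fun q hq => by rw [hNb, hNP _ (hQP q hq), map_zero]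
  have hNbim : ∀ v, Nb v ∈ H.piece 0 1 := fun v => by rw [hNb]; exact hPQ _ (hNim _)
  -- `N̄ W⁺ ⊆ W⁻`
  have hNbWp : ∀ p ∈ W ⊓ H.piece 1 0, Nb p ∈ W ⊓ H.piece 0 1 := fun p hp => by
    refine Submodule.mem_inf.2 ⟨?_, hNbim p⟩
    rw [hNb]
    refine hcWbar _ (UnitaryTheta.apply_mem_eigenspace_of_commute (hcφ hN) (hcW p (Submodule.mem_inf.1 hp).1))
  -- `R = [N, N̄]` preserves the Hodge pieces and acts on `W⁺` as `p ↦ η(N̄ p) u`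
  set R := N * Nb - Nb * N with hRdef
  have hR𝔥 : R ∈ H.hodgeLieC := H.commutator_mem_hodgeLieC hN hNb𝔥
  have hRP : ∀ p ∈ H.piece 1 0, R p ∈ H.piece 1 0 := fun p hp => by
    rw [hRdef, LinearMap.sub_apply, Module.End.mul_apply, Module.End.mul_apply, hNP p hp, map_zero, sub_zero]
    exact hNim _
  have hRQ : ∀ q ∈ H.piece 0 1, R q ∈ H.piece 0 1 := fun q hq => by
    rw [hRdef, LinearMap.sub_apply, Module.End.mul_apply, Module.End.mul_apply, hNbQ q hq, map_zero, zero_sub]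
    exact Submodule.neg_mem _ (hNbim _)
  have hRW : ∀ p ∈ W ⊓ H.piece 1 0, R p = η (Nb p) • u := fun p hp => by
    rw [hRdef, LinearMap.sub_apply, Module.End.mul_apply, Module.End.mul_apply, hNP p (Submodule.mem_inf.1 hp).2, map_zero,
      sub_zero, hNW _ (hNbWp p hp)]
  -- `η(N̄ u) ≠ 0` by positivity
  have hskewN : ∀ x y, ψC (N x) y = -ψC x (N y) := fun x y => formBaseChange_skew_of_mem_hodgeLieC ψ hN x y
  have hcast : ((((1 : ℤ).negOnePow : ℤˣ) : ℤ) : ℂ) ≠ 0 := Int.cast_ne_zero.2 (Units.ne_zero _)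
  obtain ⟨w₀, hw₀, hNw₀⟩ := hN0
  have hηw₀ : η w₀ ≠ 0 := fun h => hNw₀ (by rw [hNW w₀ hw₀, h, zero_smul])
  have hu0 : u ≠ 0 := fun h => hNw₀ (by rw [hNW w₀ hw₀, h, smul_zero])
  set z := N (conj u) with hzdef
  have hzP : z ∈ H.piece 1 0 := hNim _
  have hz0 : z ≠ 0 := by
    intro hz
    -- `ψC z w₀ = −η(w₀) ψC (conj u) u ≠ 0`
    have h1 : ψC z w₀ = -(η w₀ • ψC (conj u) u) := by
      rw [hzdef, hskewN, hNW w₀ hw₀, map_smul]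
    have h2 : ψC (conj u) u ≠ 0 := by
      rw [ψ.form_baseChange_swap u (conj u)]
      exact mul_ne_zero hcast (ψ.form_conj_ne_zero (p := 1) (q := 0) (by norm_num) huP hu0)
    rw [hz, LinearMap.map_zero, LinearMap.zero_apply, eq_comm, neg_eq_zero, smul_eq_mul] at h1
    exact mul_ne_zero hηw₀ h2 h1
  have hηNbu : η (Nb u) ≠ 0 := by
    intro h0
    have hRu : R u = 0 := by rw [hRW u hu, h0, zero_smul]
    -- `ψC (R u) (conj u) = ψC (N (N̄ u)) (conj u) = −ψC (N̄ u) z = −ψC (conj z) z ≠ 0`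
    have h1 : ψC (R u) (conj u) = -ψC (conj z) z := by
      rw [hRdef, LinearMap.sub_apply, Module.End.mul_apply, Module.End.mul_apply, hNP u huP, map_zero, sub_zero, hskewN,
        hNb, ← hzdef]
    have h2 : ψC (conj z) z ≠ 0 := by
      rw [ψ.form_baseChange_swap z (conj z)]
      exact mul_ne_zero hcast (ψ.form_conj_ne_zero (p := 1) (q := 0) (by norm_num) hzP hz0)
    rw [hRu, LinearMap.map_zero, LinearMap.zero_apply, eq_comm, neg_eq_zero] at h1
    exact h2 h1
  -- §1 with `Y₀ = R`, `α = η ∘ N̄ ∘ subtype`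
  set Wp := W ⊓ H.piece 1 0 with hWpdef
  refine WeilSquare.exists_restrict_plus_eq_of_smulRight H rfl heff ψ hφE hd hφ2 hE hμ hR𝔥 hRP hRQ
    ((η ∘ₗ Nb) ∘ₗ Wp.subtype) ⟨u, hu⟩ (by simpa using hηNbu) fun p => ?_
  rw [hRW p p.2]
  rfl

set_option maxHeartbeats 1600000 in
/-- **The same on `W⁻`: `𝔊⁰|_{W⁻} = End(W⁻)`** — `[N̄, N]` acts on `W⁻` as `w ↦ η(w) N̄ u`, rank one with the non-zero «trace»
`η(N̄ u)`; irreducibility of `W⁻` by S0 `WeilSquare.eq_bot_or_eq_minus_of_stable`. [cite: Gordon1997, §6 (proof of Thm. 6.3.3, pp. 18–19)]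
[cite: MoonenZarhin1999LowDim, §2 (2.3)] -/
theorem WeilSquare.exists_restrict_minus_eq_of_rankOne (H : HodgeStructure V n) (hn : n = 1) (heff : H.IsEffective)
    (ψ : H.Polarization) {φ : Module.End ℚ V} (hφE : φ ∈ H.endAlg) {d : ℚ} (hd : 0 < d) (hφ2 : φ * φ = -(d • 1))
    (hE : ∀ a ∈ H.endAlg, ∃ x y : ℚ, a = x • 1 + y • φ) {μ : ℂ} (hμ : μ ^ 2 = -(d : ℂ))
    {N : Module.End ℂ (ℂ ⊗[ℚ] V)} (hN : N ∈ H.hodgeLieC) (hNP : ∀ p ∈ H.piece 1 0, N p = 0) (hNim : ∀ v, N v ∈ H.piece 1 0)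
    {η : Module.Dual ℂ (ℂ ⊗[ℚ] V)} {u : ℂ ⊗[ℚ] V} (hu : u ∈ Module.End.eigenspace (φ.baseChange ℂ) μ ⊓ H.piece 1 0)
    (hNW : ∀ w ∈ Module.End.eigenspace (φ.baseChange ℂ) μ ⊓ H.piece 0 1, N w = η w • u)
    (hN0 : ∃ w ∈ Module.End.eigenspace (φ.baseChange ℂ) μ ⊓ H.piece 0 1, N w ≠ 0) :
    ∀ F : Module.End ℂ ↥(Module.End.eigenspace (φ.baseChange ℂ) μ ⊓ H.piece 0 1),
      ∃ Y ∈ H.hodgeLieC, (∀ p ∈ H.piece 1 0, Y p ∈ H.piece 1 0) ∧ (∀ q ∈ H.piece 0 1, Y q ∈ H.piece 0 1) ∧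
        ∀ w : ↥(Module.End.eigenspace (φ.baseChange ℂ) μ ⊓ H.piece 0 1), Y w = F w := by
  classical
  -- obtain the `W⁺` statement's ingredients: we re-run the construction of `R = [N, N̄]` and read it on `W⁻`
  subst hn
  set W := Module.End.eigenspace (φ.baseChange ℂ) μ with hWdef
  set ψC := ψ.form.baseChange ℂ with hψC
  obtain ⟨hμ0, hμc⟩ := UnitaryTheta.conj_eq_neg_of_sq hd hμ
  obtain ⟨huW, huP⟩ := Submodule.mem_inf.1 hu
  have hcφ : ∀ {Y}, Y ∈ H.hodgeLieC → Y * φ.baseChange ℂ = φ.baseChange ℂ * Y := fun {Y} hY =>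
    H.commute_baseChange_of_mem_hodgeLieC hY ⟨φ, hφE⟩
  have hPQ : ∀ x ∈ H.piece 1 0, conj x ∈ H.piece 0 1 := fun x hx => conj_mem_piece H hx
  have hQP : ∀ x ∈ H.piece 0 1, conj x ∈ H.piece 1 0 := fun x hx => conj_mem_piece H hx
  have hcW : ∀ x ∈ W, conj x ∈ Module.End.eigenspace (φ.baseChange ℂ) (-μ) := fun x hx =>
    (UnitaryTheta.conj_mem_eigenspace_iff φ hμc x).2 hx
  have hcWbar : ∀ x ∈ Module.End.eigenspace (φ.baseChange ℂ) (-μ), conj x ∈ W := fun x hx =>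
    (UnitaryTheta.conj_mem_eigenspace_iff' φ hμc x).2 hx
  obtain ⟨Nb, hNb⟩ := exists_conjOp N
  have hNb𝔥 : Nb ∈ H.hodgeLieC := by
    rw [hodgeLieC_eq_spanC] at hN ⊢
    exact conjOp_mem_spanC hN hNb
  have hNbQ : ∀ q ∈ H.piece 0 1, Nb q = 0 := fun q hq => by rw [hNb, hNP _ (hQP q hq), map_zero]
  have hNbim : ∀ v, Nb v ∈ H.piece 0 1 := fun v => by rw [hNb]; exact hPQ _ (hNim _)
  have hNbuW : Nb u ∈ W ⊓ H.piece 0 1 := by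
    refine Submodule.mem_inf.2 ⟨?_, hNbim u⟩
    rw [hNb]
    exact hcWbar _ (UnitaryTheta.apply_mem_eigenspace_of_commute (hcφ hN) (hcW u huW))
  -- `R' = [N̄, N]` on `W⁻`: `w ↦ η(w) N̄ u`
  set R' := Nb * N - N * Nb with hR'def
  have hR'𝔥 : R' ∈ H.hodgeLieC := H.commutator_mem_hodgeLieC hNb𝔥 hN
  have hR'P : ∀ p ∈ H.piece 1 0, R' p ∈ H.piece 1 0 := fun p hp => by
    rw [hR'def, LinearMap.sub_apply, Module.End.mul_apply, Module.End.mul_apply, hNP p hp, map_zero, zero_sub]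
    exact Submodule.neg_mem _ (hNim _)
  have hR'Q : ∀ q ∈ H.piece 0 1, R' q ∈ H.piece 0 1 := fun q hq => by
    rw [hR'def, LinearMap.sub_apply, Module.End.mul_apply, Module.End.mul_apply, hNbQ q hq, map_zero, sub_zero]
    exact hNbim _
  have hR'W : ∀ w ∈ W ⊓ H.piece 0 1, R' w = η w • Nb u := fun w hw => by
    rw [hR'def, LinearMap.sub_apply, Module.End.mul_apply, Module.End.mul_apply, hNbQ w (Submodule.mem_inf.1 hw).2, map_zero,
      sub_zero, hNW w hw, map_smul]
  -- `η(N̄ u) ≠ 0` (as in the `W⁺` case)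
  have hskewN : ∀ x y, ψC (N x) y = -ψC x (N y) := fun x y => formBaseChange_skew_of_mem_hodgeLieC ψ hN x y
  have hcast : ((((1 : ℤ).negOnePow : ℤˣ) : ℤ) : ℂ) ≠ 0 := Int.cast_ne_zero.2 (Units.ne_zero _)
  obtain ⟨w₀, hw₀, hNw₀⟩ := hN0
  have hηw₀ : η w₀ ≠ 0 := fun h => hNw₀ (by rw [hNW w₀ hw₀, h, zero_smul])
  have hu0 : u ≠ 0 := fun h => hNw₀ (by rw [hNW w₀ hw₀, h, smul_zero])
  set z := N (conj u) with hzdef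
  have hzP : z ∈ H.piece 1 0 := hNim _
  have hz0 : z ≠ 0 := by
    intro hz
    have h1 : ψC z w₀ = -(η w₀ • ψC (conj u) u) := by
      rw [hzdef, hskewN, hNW w₀ hw₀, map_smul]
    have h2 : ψC (conj u) u ≠ 0 := by
      rw [ψ.form_baseChange_swap u (conj u)]
      exact mul_ne_zero hcast (ψ.form_conj_ne_zero (p := 1) (q := 0) (by norm_num) huP hu0)
    rw [hz, LinearMap.map_zero, LinearMap.zero_apply, eq_comm, neg_eq_zero, smul_eq_mul] at h1
    exact mul_ne_zero hηw₀ h2 h1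
  have hNbuW' : Nb u ∈ W ⊓ H.piece 0 1 := hNbuW
  have hηNbu : η (Nb u) ≠ 0 := by
    intro h0
    have hNNbu : N (Nb u) = 0 := by rw [hNW _ hNbuW, h0, zero_smul]
    have h1 : ψC (N (Nb u)) (conj u) = -ψC (conj z) z := by rw [hskewN, hNb, ← hzdef]
    have h2 : ψC (conj z) z ≠ 0 := by
      rw [ψ.form_baseChange_swap z (conj z)]
      exact mul_ne_zero hcast (ψ.form_conj_ne_zero (p := 1) (q := 0) (by norm_num) hzP hz0)
    rw [hNNbu, LinearMap.map_zero, LinearMap.zero_apply, eq_comm, neg_eq_zero] at h1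
    exact h2 h1
  -- the packaging of §1, on `W⁻` (irreducibility by `WeilSquare.eq_bot_or_eq_minus_of_stable`)
  set Wm := W ⊓ H.piece 0 1 with hWmdef
  set G0 : Submodule ℂ (Module.End ℂ (ℂ ⊗[ℚ] V)) :=
    { carrier := {Y | Y ∈ H.hodgeLieC ∧ (∀ p ∈ H.piece 1 0, Y p ∈ H.piece 1 0) ∧ (∀ q ∈ H.piece 0 1, Y q ∈ H.piece 0 1)}
      zero_mem' := ⟨Submodule.zero_mem _, fun p _ => by rw [LinearMap.zero_apply]; exact Submodule.zero_mem _,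
        fun q _ => by rw [LinearMap.zero_apply]; exact Submodule.zero_mem _⟩
      add_mem' := fun {Y Y'} hY hY' => ⟨Submodule.add_mem _ hY.1 hY'.1,
        fun p hp => by rw [LinearMap.add_apply]; exact Submodule.add_mem _ (hY.2.1 p hp) (hY'.2.1 p hp),
        fun q hq => by rw [LinearMap.add_apply]; exact Submodule.add_mem _ (hY.2.2 q hq) (hY'.2.2 q hq)⟩
      smul_mem' := fun c Y hY => ⟨Submodule.smul_mem _ c hY.1,
        fun p hp => by rw [LinearMap.smul_apply]; exact Submodule.smul_mem _ c (hY.2.1 p hp),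
        fun q hq => by rw [LinearMap.smul_apply]; exact Submodule.smul_mem _ c (hY.2.2 q hq)⟩ } with hG0def
  have hG0W : ∀ Y : G0, ∀ x ∈ Wm, (Y : Module.End ℂ (ℂ ⊗[ℚ] V)) x ∈ Wm := fun Y x hx =>
    Submodule.mem_inf.2 ⟨UnitaryTheta.apply_mem_eigenspace_of_commute (hcφ Y.2.1) (Submodule.mem_inf.1 hx).1,
      Y.2.2.2 x (Submodule.mem_inf.1 hx).2⟩
  have hG0br : ∀ Y ∈ G0, ∀ Y' ∈ G0, Y * Y' - Y' * Y ∈ G0 := fun Y hY Y' hY' =>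
    ⟨H.commutator_mem_hodgeLieC hY.1 hY'.1,
      fun p hp => by
        rw [LinearMap.sub_apply, Module.End.mul_apply, Module.End.mul_apply]
        exact Submodule.sub_mem _ (hY.2.1 _ (hY'.2.1 p hp)) (hY'.2.1 _ (hY.2.1 p hp)),
      fun q hq => by
        rw [LinearMap.sub_apply, Module.End.mul_apply, Module.End.mul_apply]
        exact Submodule.sub_mem _ (hY.2.2 _ (hY'.2.2 q hq)) (hY'.2.2 _ (hY.2.2 q hq))⟩
  set res : G0 →ₗ[ℂ] Module.End ℂ ↥Wm :=
    { toFun := fun Y => (Y : Module.End ℂ (ℂ ⊗[ℚ] V)).restrict (hG0W Y)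
      map_add' := fun Y Y' => LinearMap.ext fun w => Subtype.ext rfl
      map_smul' := fun c Y => LinearMap.ext fun w => Subtype.ext rfl } with hres
  have hresapply : ∀ (Y : G0) (w : Wm), ((res Y w : Wm) : ℂ ⊗[ℚ] V) = (Y : Module.End ℂ (ℂ ⊗[ℚ] V)) w := fun Y w => rfl
  set 𝔏 : Submodule ℂ (Module.End ℂ ↥Wm) := LinearMap.range res with h𝔏def
  have h𝔏br : ∀ A ∈ 𝔏, ∀ B ∈ 𝔏, A * B - B * A ∈ 𝔏 := by
    rintro _ ⟨Y, rfl⟩ _ ⟨Y', rfl⟩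
    refine ⟨⟨(Y : Module.End ℂ (ℂ ⊗[ℚ] V)) * (Y' : Module.End ℂ (ℂ ⊗[ℚ] V)) -
        (Y' : Module.End ℂ (ℂ ⊗[ℚ] V)) * (Y : Module.End ℂ (ℂ ⊗[ℚ] V)), hG0br Y Y.2 Y' Y'.2⟩, LinearMap.ext fun w => Subtype.ext ?_⟩
    simp only [hresapply, LinearMap.sub_apply, Module.End.mul_apply, Submodule.coe_sub]
  have h𝔏irr : ∀ U : Submodule ℂ ↥Wm, (∀ A ∈ 𝔏, ∀ x ∈ U, A x ∈ U) → U = ⊥ ∨ U = ⊤ := by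
    intro U hU
    set U₀ : Submodule ℂ (ℂ ⊗[ℚ] V) := U.map Wm.subtype with hU₀
    have hU₀le : U₀ ≤ Wm := by
      rintro _ ⟨x, -, rfl⟩; exact x.2
    have hU₀st : ∀ Y ∈ H.hodgeLieC, (∀ p ∈ H.piece 1 0, Y p ∈ H.piece 1 0) → (∀ q ∈ H.piece 0 1, Y q ∈ H.piece 0 1) →
        ∀ x ∈ U₀, Y x ∈ U₀ := by
      rintro Y hY hYP hYQ _ ⟨x, hx, rfl⟩
      have h := hU (res ⟨Y, hY, hYP, hYQ⟩) (LinearMap.mem_range_self res _) x hx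
      exact ⟨_, h, rfl⟩
    rcases WeilSquare.eq_bot_or_eq_minus_of_stable H rfl heff ψ hφE hd hφ2 hE hμ U₀ hU₀le hU₀st with h | h
    · left
      rw [eq_bot_iff]
      intro x hx
      have hx0 : (x : ℂ ⊗[ℚ] V) ∈ U₀ := ⟨x, hx, rfl⟩
      rw [h, Submodule.mem_bot] at hx0
      rw [Submodule.mem_bot]
      exact Subtype.ext hx0
    · right
      apply Submodule.map_injective_of_injective Wm.injective_subtype
      rw [Submodule.map_subtype_top]
      exact h
  -- the rank-one element `R'|_{W⁻} = (η ∘ subtype).smulRight (N̄ u)`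
  have hP : ((η ∘ₗ Wm.subtype).smulRight (⟨Nb u, hNbuW⟩ : Wm)) ∈ 𝔏 := by
    refine ⟨⟨R', hR'𝔥, hR'P, hR'Q⟩, LinearMap.ext fun w => Subtype.ext ?_⟩
    rw [hresapply, LinearMap.smulRight_apply, Submodule.coe_smul, LinearMap.comp_apply, Submodule.subtype_apply]
    exact hR'W w w.2
  have hαu : (η ∘ₗ Wm.subtype) (⟨Nb u, hNbuW⟩ : Wm) ≠ 0 := by simpa using hηNbu
  have htop := Literature.Algebra.Lie.eq_top_of_irreducible_of_smulRight_mem h𝔏br h𝔏irr hP hαu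
  intro F
  have hF : F ∈ 𝔏 := htop ▸ Submodule.mem_top
  obtain ⟨Y, hY⟩ := hF
  refine ⟨Y, Y.2.1, Y.2.2.1, Y.2.2.2, fun w => ?_⟩
  rw [← hY, hresapply]

end HodgeStructure

end Literature.AlgebraicGeometry.Motives

end
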